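import Literature.ModelTheory.ExponentialFields.ETheory
import Mathlib.Analysis.Analytic.Polynomial
import Mathlib.Analysis.SpecialFunctions.ExpDeriv
import HarnessLib

/-!
# Wilkie 1996, §10 / den Besten, Theorems 7.1.22 and 7.2.1: the smooth functions of `T_e` — graphs, extreme values and Taylor approximation in the models of `T_exp`

Topic `Literature/ModelTheory/ExponentialFields`.  The analytic core of the proof of the
valuation inequality for `T_e` (M. den Besten, *Wilkie's Theorem and the Uniform Real Schanuel
Conjecture*, MSc thesis, Utrecht 2016, proof of Theorem 7.1.22, pp. 87–89; A. J. Wilkie, J. Amer.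
Math. Soc. 9 (1996), §10; the hypothesis `hsurj` of `Wilkie1996AbsoluteInequality.lean`) works
with the `C^∞`-functions `F` of the smoothness condition `S₂` (Definition 7.1.20 (ii)) and uses two
facts about them **in an arbitrary model `K`**, both "by transfer from `ℝ`":

> p. 87: "By transfer of the Extreme Value Theorem to `K`, `h` must attain a minimum on the set
> `([0,1] ∖ (d/2, 2d/3)) × A`, as this set is closed, bounded and definable."
>
> p. 88: "consider the Taylor expansion of degree `λ` of the function `F : K^{r+1+m} → K`, at the
> point `ω⃗` … The justification, of course, is that we can transfer Taylor's Theorem from `ℝ`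
> to `K`. … there exists a positive element `B_λ` of `k` such that for all `t ∈ K`, with
> `1 > t > 0` and all `z⃗` with `‖z⃗ - ω⃗‖ < t` holds `|F(z⃗) - ρ_λ(z⃗)| < B_λ · t^{λ+1}`. (40)"

For `T_e` the functions in question are `z ↦ P(z, e(zᵢ), ẽ(z_j))` for integer polynomials `P`,
`e(x) = exp((1 + x²)⁻¹)` and `ẽ(y) = e(y / (1 - y²))` (`= 1` at `y² = 1`), the analytic
continuation of `e` along the algebraic compactification `y ↦ y / (1 - y²)` of the line
(`Wilkie1996SmoothnessS2.lean`).  This file provides, with the variables split into parameters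
`α` and blocks `β` (arguments of `e`) and `κ` (arguments of `ẽ`):

* `SmoothFunctions.exists_term_realize_eq_aeval` — integer polynomials are terms;
* `SmoothFunctions.exists_eFormula_graph` — **the graph of `F_P` is defined by one `L_e`-formula**,
  uniformly in all ordered fields with `e`;
* `SmoothFunctions.analyticAt_aeval_e` — over `ℝ`, `F_P` is real-analytic (`Real.etilde_eq`:
  `ẽ(y) = exp((1 - y²)² / ((1 - y²)² + y²))`; Mathlib's `AnalyticAt.aeval_mvPolynomial`);
* `SmoothFunctions.exists_isMinOn_box` — **the extreme value theorem for `|F_P(u, ·)|` on closed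
  boxes in every model of `T_exp`** (`exists_eFormula_isMinOn_box`: "`p₀` minimizes over the box"
  is one `L_e`-formula in `(u, lo, hi; p₀)` — for pulling minimizers into elementary substructures;
  `exists_eSentence_isMinOn_box`: one `L_e`-sentence; `real_models_isMinOn_box`: true in `ℝ` by
  compactness; transfer by `RealExpModel.realize_eSentence_iff_real`);
* `SmoothFunctions.exists_taylor` — **Taylor approximation (40) in every model of `T_exp`**: for
  every degree `deg`, parameters `u` and centre `ω` there are `r₀ > 0`, coefficients
  `c_{k,j}` (`k ≤ deg`, `j : Fin k → β ⊕ κ`) and `B ≥ 0` with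
  `|F_P(u, p) - Σ c_{k,j} Πₗ (p_{jₗ} - ω_{jₗ})| ≤ B t^{deg+1}` for `0 < t < r₀`, `‖p - ω‖ < t`
  (`real_taylor`: over `ℝ` from the power series of the analytic `F_P`,
  `HasFPowerSeriesOnBall.uniform_geometric_approx'`, the partial sums expanded into monomials
  by multilinearity; `exists_eFormula_taylor`: the bound as one `L_e`-formula in
  `(u, ω; r₀, B, c)` — for pulling `r₀, B, c` into elementary substructures;
  `exists_eSentence_taylor`: one `L_e`-sentence, the coefficients being existentially
  quantified; transfer).  The radius `r₀` replaces den Besten's `t < 1`, and the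
  `k`-rationality of `r₀, c, B` (his "we can calculate these bounds in `k`") is left to the user
  (elementarity of `k`).

Nothing here is a named fact; no definition is introduced.

## References

* M. den Besten, *Wilkie's Theorem and the Uniform Real Schanuel Conjecture*, MSc thesis, Utrecht
  (2016): Definition 7.1.20, Theorem 7.1.22 (pp. 87–88, (40)), Theorem 7.2.1. [DenBesten2016]
* A. J. Wilkie, *Model completeness results for expansions of the ordered field of real numbers by
  restricted Pfaffian functions and the exponential function*, J. Amer. Math. Soc. 9 (1996),
  1051–1094, §10. [WilkieJAMS1996]
-/

noncomputable section

open Set FirstOrder FirstOrder.Language FirstOrder.Language.Structure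

namespace Literature.ModelTheory.ExponentialFields

namespace SmoothFunctions

/-! ### Integer polynomials are terms -/

/-- A term of the language of ordered rings for the integer `a`. [folklore] -/
theorem exists_term_intCast {ι : Type*} (a : ℤ) :
    ∃ t : Language.orderedRing.Term ι, ∀ (M : Type) [CommRing M] [LE M] (v : ι → M),
      t.realize v = (a : M) := by
  have hnat : ∀ n : ℕ, ∃ t : Language.orderedRing.Term ι, ∀ (M : Type) [CommRing M] [LE M]
      (v : ι → M), t.realize v = (n : M) := by
    intro n
    induction n with
    | zero => exact ⟨0, fun M _ _ v => by simp⟩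
    | succ n ih =>
      obtain ⟨t, ht⟩ := ih
      refine ⟨t + 1, fun M _ _ v => ?_⟩
      rw [Language.orderedRing.realize_add, ht, Language.orderedRing.realize_one, Nat.cast_succ]
  obtain ⟨t, ht⟩ := hnat a.natAbs
  rcases Int.natAbs_eq a with h | h
  · refine ⟨t, fun M _ _ v => ?_⟩
    rw [ht, h, Int.cast_natCast, Int.natAbs_natCast]
  · refine ⟨-t, fun M _ _ v => ?_⟩
    rw [Language.orderedRing.realize_neg, ht]
    conv_rhs => rw [h]
    simp

/-- **Every integer polynomial is realized by a term of the language of ordered rings.**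
[folklore] -/
theorem exists_term_realize_eq_aeval {ι : Type*} (P : MvPolynomial ι ℤ) :
    ∃ t : Language.orderedRing.Term ι, ∀ (M : Type) [CommRing M] [LE M] (v : ι → M),
      t.realize v = MvPolynomial.aeval v P := by
  induction P using MvPolynomial.induction_on with
  | C a =>
    obtain ⟨t, ht⟩ := exists_term_intCast (ι := ι) a
    refine ⟨t, fun M _ _ v => ?_⟩
    rw [ht, MvPolynomial.aeval_C, eq_intCast]
  | add p q hp hq =>
    obtain ⟨t₁, h₁⟩ := hp
    obtain ⟨t₂, h₂⟩ := hq
    exact ⟨t₁ + t₂, fun M _ _ v => by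
      rw [Language.orderedRing.realize_add, h₁, h₂, map_add]⟩
  | mul_X p i hp =>
    obtain ⟨t, ht⟩ := hp
    exact ⟨t * Term.var i, fun M _ _ v => by
      rw [Language.orderedRing.realize_mul, ht, Term.realize_var, map_mul, MvPolynomial.aeval_X]⟩

/-- A term for `v(a)^k`. [folklore] -/
theorem exists_term_pow {ι : Type*} (a : ι) (k : ℕ) :
    ∃ t : Language.orderedRing.Term ι, ∀ (M : Type) [CommRing M] [LE M] (v : ι → M),
      t.realize v = v a ^ k := by
  induction k with
  | zero => exact ⟨1, fun M _ _ v => by simp⟩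
  | succ k ih =>
    obtain ⟨t, ht⟩ := ih
    refine ⟨t * Term.var a, fun M _ _ v => ?_⟩
    rw [Language.orderedRing.realize_mul, ht, Term.realize_var, pow_succ]

/-! ### The functions `z ↦ P(z, e(z), ẽ(z))` and their graphs

The smooth functions of the smoothness condition `S₂` for `T_e` (den Besten 2016,
Definition 7.1.20 (ii) and proof of Theorem 7.2.1) are, in the models of `T_exp`, the functions
`z ↦ P(z, e(zᵢ) (i ∈ α ⊕ β), ẽ(z_j) (j ∈ κ))` for an integer polynomial `P`, where
`e(x) = exp((1 + x²)⁻¹)` and `ẽ(y) = e(y / (1 - y²))` (`= 1` for `y² = 1`) is the analytic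
continuation to `[-1, 1]` of `e` along the algebraic compactification `y ↦ y / (1 - y²)` of the
line (a variant of den Besten's `e*(x) = e(x⁻¹)`, p. 91, avoiding the case distinction over the
subsets `s`).  The variables are split into parameters `α`, and two blocks `β`, `κ` over which
extreme values and Taylor expansions will be taken. -/

section Graph

variable {α β κ : Type} [Fintype α] [Fintype β] [Fintype κ]

/-- **The graph of `z ↦ P(z, e(z), ẽ(z))` is defined by one `L_e`-formula**, uniformly in all
ordered fields with a function `e` (in particular in `ℝ` and in every model of `T_exp`).
[cite: DenBesten2016, Theorem 7.2.1 (proof)] -/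
theorem exists_eFormula_graph (P : MvPolynomial ((α ⊕ (β ⊕ κ)) ⊕ (α ⊕ (β ⊕ κ))) ℤ) :
    ∃ χ : Language.orderedERing.Formula ((α ⊕ (β ⊕ κ)) ⊕ Fin 1),
      ∀ (M : Type) [Field M] [LinearOrder M] [IsStrictOrderedRing M] [EFun M]
        (z : α ⊕ (β ⊕ κ) → M) (t : M),
        χ.Realize (Sum.elim z ![t]) ↔
          t = MvPolynomial.aeval
            (Sum.elim z (Sum.elim (fun i => EFun.e (z (Sum.inl i)))
              (Sum.elim (fun i => EFun.e (z (Sum.inr (Sum.inl i))))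
                (fun j => if z (Sum.inr (Sum.inr j)) ^ 2 = 1 then 1
                  else EFun.e (z (Sum.inr (Sum.inr j)) / (1 - z (Sum.inr (Sum.inr j)) ^ 2)))))) P := by
  classical
  -- variables: `((z, t) , E)` with `E` the block of values of `e`, `ẽ`
  obtain ⟨tP, htP⟩ := exists_term_realize_eq_aeval P
  let φr : Language.orderedRing →ᴸ Language.orderedERing := LHom.sumInl
  -- shorthands for variables of the body
  let V := ((α ⊕ (β ⊕ κ)) ⊕ Fin 1) ⊕ (α ⊕ (β ⊕ κ))
  let zv : α ⊕ (β ⊕ κ) → Language.orderedRing.Term V := fun c => Term.var (Sum.inl (Sum.inl c))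
  let Ev : α ⊕ (β ⊕ κ) → Language.orderedRing.Term V := fun c => Term.var (Sum.inr c)
  let eT : Language.orderedERing.Term V → Language.orderedERing.Term V := fun τ =>
    Term.func (Sum.inr eFunc.e : Language.orderedERing.Functions 1) ![τ]
  -- graph of `e` at the coordinate `c`
  let Ge : α ⊕ (β ⊕ κ) → Language.orderedERing.Formula V := fun c =>
    Term.equal (φr.onTerm (Ev c)) (eT (φr.onTerm (zv c)))
  -- graph of `ẽ` at the coordinate `c`: `(y² = 1 ∧ E = 1) ∨ (y² ≠ 1 ∧ ∃ w (w (1 - y²) = y ∧ E = e(w)))`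
  let zv' : α ⊕ (β ⊕ κ) → Language.orderedRing.Term (V ⊕ Fin 1) := fun c =>
    Term.var (Sum.inl (Sum.inl (Sum.inl c)))
  let Ev' : α ⊕ (β ⊕ κ) → Language.orderedRing.Term (V ⊕ Fin 1) := fun c =>
    Term.var (Sum.inl (Sum.inr c))
  let wv : Language.orderedRing.Term (V ⊕ Fin 1) := Term.var (Sum.inr 0)
  let eT' : Language.orderedERing.Term (V ⊕ Fin 1) → Language.orderedERing.Term (V ⊕ Fin 1) :=
    fun τ => Term.func (Sum.inr eFunc.e : Language.orderedERing.Functions 1) ![τ]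
  let Gt : α ⊕ (β ⊕ κ) → Language.orderedERing.Formula V := fun c =>
    (φr.onFormula (Term.equal (zv c * zv c) 1 ⊓ Term.equal (Ev c) 1)) ⊔
      ((φr.onFormula (Term.equal (zv c * zv c) 1)).not ⊓
        Formula.iExs (Fin 1)
          (φr.onFormula (Term.equal (wv * (1 + -(zv' c * zv' c))) (zv' c)) ⊓
            Term.equal (φr.onTerm (Ev' c)) (eT' (φr.onTerm wv))))
  let G : α ⊕ (β ⊕ κ) → Language.orderedERing.Formula V := fun c =>
    match c with
    | Sum.inl i => Ge (Sum.inl i)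
    | Sum.inr (Sum.inl i) => Ge (Sum.inr (Sum.inl i))
    | Sum.inr (Sum.inr j) => Gt (Sum.inr (Sum.inr j))
  -- the value: `t = P(z, E)`
  let ρ : (α ⊕ (β ⊕ κ)) ⊕ (α ⊕ (β ⊕ κ)) → V := Sum.elim (fun c => Sum.inl (Sum.inl c)) Sum.inr
  let Val : Language.orderedERing.Formula V :=
    Term.equal (φr.onTerm (Term.var (Sum.inl (Sum.inr 0)))) (φr.onTerm (tP.relabel ρ))
  refine ⟨Formula.iExs (α ⊕ (β ⊕ κ)) (Formula.iInf G ⊓ Val), ?_⟩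
  intro M _ _ _ _ z t
  -- the intended values of the `E`-block
  set EE : α ⊕ (β ⊕ κ) → M := Sum.elim (fun i => EFun.e (z (Sum.inl i)))
    (Sum.elim (fun i => EFun.e (z (Sum.inr (Sum.inl i))))
      (fun j => if z (Sum.inr (Sum.inr j)) ^ 2 = 1 then 1
        else EFun.e (z (Sum.inr (Sum.inr j)) / (1 - z (Sum.inr (Sum.inr j)) ^ 2)))) with hEE
  -- semantics of the pieces, at the valuation `((z, t), E)`
  have hGe : ∀ (E : α ⊕ (β ⊕ κ) → M) (c : α ⊕ (β ⊕ κ)),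
      (Ge c).Realize (Sum.elim (Sum.elim z ![t]) E) ↔ E c = EFun.e (z c) := by
    intro E c
    simp only [Ge, Formula.realize_equal, LHom.realize_onTerm, Term.realize_var, Ev, zv, eT,
      Term.realize_func, Sum.elim_inr]
    exact Iff.rfl
  have hGt : ∀ (E : α ⊕ (β ⊕ κ) → M) (c : α ⊕ (β ⊕ κ)),
      (Gt c).Realize (Sum.elim (Sum.elim z ![t]) E) ↔
        E c = (if z c ^ 2 = 1 then 1 else EFun.e (z c / (1 - z c ^ 2))) := by
    intro E c
    have hsq : ∀ u : M, u * u = 1 ↔ u ^ 2 = 1 := fun u => by rw [sq]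
    simp only [Gt, Formula.realize_sup, Formula.realize_inf, Formula.realize_not,
      LHom.realize_onFormula, Formula.realize_equal, Language.orderedRing.realize_mul,
      Language.orderedRing.realize_one, Language.orderedRing.realize_add,
      Language.orderedRing.realize_neg, Term.realize_var,
      zv, Ev, zv', Ev', wv, eT', LHom.realize_onTerm, Term.realize_func, Sum.elim_inl,
      Sum.elim_inr, Formula.realize_iExs, hsq]
    by_cases h : z c ^ 2 = 1
    · simp [h]
    · simp only [h, false_and, not_false_eq_true, true_and, false_or, if_false]
      have h1 : (1 : M) - z c ^ 2 ≠ 0 := sub_ne_zero.2 (Ne.symm h)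
      have h1' : (1 : M) + -(z c * z c) = 1 - z c ^ 2 := by ring
      constructor
      · rintro ⟨w, hw, hE⟩
        have hw' : w 0 * (1 + -(z c * z c)) = z c := by simpa using hw
        rw [h1'] at hw'
        have hw0 : w 0 = z c / (1 - z c ^ 2) := (eq_div_iff h1).2 hw'
        have hE' : E c = EFun.e (w 0) := hE
        rw [hE', hw0]
      · intro hE
        refine ⟨fun _ => z c / (1 - z c ^ 2), ?_, ?_⟩
        · show (fun _ : Fin 1 => z c / (1 - z c ^ 2)) 0 * (1 + -(z c * z c)) = z c
          rw [h1']
          exact div_mul_cancel₀ _ h1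
        · exact hE
  have hG : ∀ (E : α ⊕ (β ⊕ κ) → M) (c : α ⊕ (β ⊕ κ)),
      (G c).Realize (Sum.elim (Sum.elim z ![t]) E) ↔ E c = EE c := by
    intro E c
    rcases c with i | i | j
    · exact hGe E (Sum.inl i)
    · exact hGe E (Sum.inr (Sum.inl i))
    · rw [show G (Sum.inr (Sum.inr j)) = Gt (Sum.inr (Sum.inr j)) from rfl, hGt]
      simp [hEE]
  have hVal : ∀ (E : α ⊕ (β ⊕ κ) → M), Val.Realize (Sum.elim (Sum.elim z ![t]) E) ↔
      t = MvPolynomial.aeval (Sum.elim z E) P := by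
    intro E
    simp only [Val, Formula.realize_equal, LHom.realize_onTerm, Term.realize_var, Sum.elim_inl,
      Sum.elim_inr, Term.realize_relabel, htP]
    have hc : (Sum.elim (Sum.elim z ![t]) E ∘ ρ) = Sum.elim z E := by
      funext c; rcases c with c | c <;> rfl
    rw [hc]
    simp
  simp only [Formula.realize_iExs, Formula.realize_inf, Formula.realize_iInf, hG, hVal]
  constructor
  · rintro ⟨E, hE, ht⟩
    have hEeq : E = EE := funext hE
    rw [ht, hEeq]
  · intro ht
    exact ⟨EE, fun c => rfl, ht⟩

end Graph

/-! ### Over the reals: `ẽ` is analytic, and so is `z ↦ P(z, e(z), ẽ(z))` -/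

section RealSide

/-- `ẽ(y) = exp((1 - y²)² / ((1 - y²)² + y²))` on `ℝ`: the closed form of `e(y / (1 - y²))`,
showing that `ẽ` is entire. [folklore] -/
theorem Real.etilde_eq (y : ℝ) :
    (if y ^ 2 = 1 then (1 : ℝ) else EFun.e (y / (1 - y ^ 2))) =
      Real.exp ((1 - y ^ 2) ^ 2 / ((1 - y ^ 2) ^ 2 + y ^ 2)) := by
  split_ifs with h
  · rw [h]; simp
  · rw [Real.e_def]
    congr 1
    have h1 : (1 : ℝ) - y ^ 2 ≠ 0 := sub_ne_zero.2 (Ne.symm h)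
    have h2 : (1 - y ^ 2) ^ 2 + y ^ 2 ≠ 0 := by
      have : 0 < (1 - y ^ 2) ^ 2 + y ^ 2 := by
        by_cases hy : y = 0
        · rw [hy]; norm_num
        · positivity
      exact this.ne'
    rw [div_pow, inv_eq_one_div, one_add_div (pow_ne_zero 2 h1), one_div_div, add_comm]

variable {α β κ : Type} [Fintype α] [Fintype β] [Fintype κ]

/-- **`z ↦ P(z, e(z), ẽ(z))` is real-analytic on `ℝ^{α ⊕ β ⊕ κ}`.** [folklore] -/
theorem analyticAt_aeval_e (P : MvPolynomial ((α ⊕ (β ⊕ κ)) ⊕ (α ⊕ (β ⊕ κ))) ℤ)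
    (z₀ : α ⊕ (β ⊕ κ) → ℝ) :
    AnalyticAt ℝ (fun z : α ⊕ (β ⊕ κ) → ℝ => MvPolynomial.aeval
      (Sum.elim z (Sum.elim (fun i => EFun.e (z (Sum.inl i)))
        (Sum.elim (fun i => EFun.e (z (Sum.inr (Sum.inl i))))
          (fun j => if z (Sum.inr (Sum.inr j)) ^ 2 = 1 then (1 : ℝ)
            else EFun.e (z (Sum.inr (Sum.inr j)) / (1 - z (Sum.inr (Sum.inr j)) ^ 2)))))) P) z₀ := by
  classical
  have hproj : ∀ c : α ⊕ (β ⊕ κ), AnalyticAt ℝ (fun z : α ⊕ (β ⊕ κ) → ℝ => z c) z₀ := fun c =>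
    (ContinuousLinearMap.proj (R := ℝ) (φ := fun _ : α ⊕ (β ⊕ κ) => ℝ) c).analyticAt z₀
  have he : ∀ c : α ⊕ (β ⊕ κ), AnalyticAt ℝ (fun z : α ⊕ (β ⊕ κ) → ℝ => EFun.e (z c)) z₀ := by
    intro c
    have h : (fun z : α ⊕ (β ⊕ κ) → ℝ => EFun.e (z c)) =
        fun z => Real.exp ((1 + z c ^ 2)⁻¹) := funext fun z => Real.e_def _
    rw [h]
    refine analyticAt_rexp.comp ((analyticAt_const.add ((hproj c).pow 2)).inv ?_)
    show (1 : ℝ) + z₀ c ^ 2 ≠ 0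
    positivity
  have het : ∀ c : α ⊕ (β ⊕ κ), AnalyticAt ℝ (fun z : α ⊕ (β ⊕ κ) → ℝ =>
      if z c ^ 2 = 1 then (1 : ℝ) else EFun.e (z c / (1 - z c ^ 2))) z₀ := by
    intro c
    have h : (fun z : α ⊕ (β ⊕ κ) → ℝ => if z c ^ 2 = 1 then (1 : ℝ)
        else EFun.e (z c / (1 - z c ^ 2))) =
        fun z => Real.exp ((1 - z c ^ 2) ^ 2 / ((1 - z c ^ 2) ^ 2 + z c ^ 2)) :=
      funext fun z => Real.etilde_eq _
    rw [h]
    refine analyticAt_rexp.comp (((analyticAt_const.sub ((hproj c).pow 2)).pow 2).div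
      (((analyticAt_const.sub ((hproj c).pow 2)).pow 2).add ((hproj c).pow 2)) ?_)
    show ((1 : ℝ) - z₀ c ^ 2) ^ 2 + z₀ c ^ 2 ≠ 0
    have : 0 < ((1 : ℝ) - z₀ c ^ 2) ^ 2 + z₀ c ^ 2 := by
      by_cases hz : z₀ c = 0
      · rw [hz]; norm_num
      · positivity
    exact this.ne'
  refine AnalyticAt.aeval_mvPolynomial (fun v => ?_) P
  rcases v with c | i | i | j
  · exact hproj c
  · exact he (Sum.inl i)
  · exact he (Sum.inr (Sum.inl i))
  · exact het (Sum.inr (Sum.inr j))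

end RealSide

/-! ### The extreme value theorem on closed boxes, transferred to the models of `T_exp` -/

section ExtremeValue

/-- `t₁ ≤ t₂` as a formula of the language of ordered rings, with its meaning. [folklore] -/
theorem realize_termLE {V : Type*} (t₁ t₂ : Language.orderedRing.Term V) (M : Type) [Field M]
    [LinearOrder M] (v : V → M) :
    Formula.Realize ((t₁.relabel Sum.inl).le (t₂.relabel Sum.inl) :
      Language.orderedRing.Formula V) v ↔ t₁.realize v ≤ t₂.realize v := by
  show BoundedFormula.Realize _ v default ↔ _
  rw [Term.realize_le]
  simp [Term.realize_relabel]

variable {α β κ : Type} [Fintype α] [Fintype β] [Fintype κ]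

/-- **The minimum formula**: "`p₀` lies in the box `[lo, hi]` and minimizes `|P(z, e(z), ẽ(z))|`,
`z = (u, p)`, over the box" is expressed by one `L_e`-formula in the variables `(u, lo, hi; p₀)`,
uniformly in all ordered fields with `e`. [cite: DenBesten2016, Theorem 7.1.22 (p. 87)] -/
theorem exists_eFormula_isMinOn_box (P : MvPolynomial ((α ⊕ (β ⊕ κ)) ⊕ (α ⊕ (β ⊕ κ))) ℤ) :
    ∃ ψ : Language.orderedERing.Formula ((α ⊕ ((β ⊕ κ) ⊕ (β ⊕ κ))) ⊕ (β ⊕ κ)),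
      ∀ (M : Type) [Field M] [LinearOrder M] [IsStrictOrderedRing M] [EFun M]
        (u : α → M) (lo hi p₀ : β ⊕ κ → M),
        ψ.Realize (Sum.elim (Sum.elim u (Sum.elim lo hi)) p₀) ↔
          ((∀ i, lo i ≤ p₀ i ∧ p₀ i ≤ hi i) ∧
            ∀ p : β ⊕ κ → M, (∀ i, lo i ≤ p i ∧ p i ≤ hi i) →
              |MvPolynomial.aeval
                  (Sum.elim (Sum.elim u p₀) (Sum.elim (fun i => EFun.e (u i))
                    (Sum.elim (fun i => EFun.e (p₀ (Sum.inl i)))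
                      (fun j => if p₀ (Sum.inr j) ^ 2 = 1 then 1
                        else EFun.e (p₀ (Sum.inr j) / (1 - p₀ (Sum.inr j) ^ 2)))))) P| ≤
              |MvPolynomial.aeval
                  (Sum.elim (Sum.elim u p) (Sum.elim (fun i => EFun.e (u i))
                    (Sum.elim (fun i => EFun.e (p (Sum.inl i)))
                      (fun j => if p (Sum.inr j) ^ 2 = 1 then 1
                        else EFun.e (p (Sum.inr j) / (1 - p (Sum.inr j) ^ 2)))))) P|) := by
  classical
  obtain ⟨χ, hχ⟩ := exists_eFormula_graph P
  let φr : Language.orderedRing →ᴸ Language.orderedERing := LHom.sumInl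
  -- `t₁ ≤ t₂` in the language of ordered rings
  let LE : ∀ {V : Type}, Language.orderedRing.Term V → Language.orderedRing.Term V →
      Language.orderedRing.Formula V := fun t₁ t₂ => (t₁.relabel Sum.inl).le (t₂.relabel Sum.inl)
  -- variable blocks
  let U := α ⊕ ((β ⊕ κ) ⊕ (β ⊕ κ))
  let V₁ := U ⊕ (β ⊕ κ)
  let V₂ := V₁ ⊕ (β ⊕ κ)
  let V₃ := V₂ ⊕ Fin 2
  -- innermost: `χ(u, p₀, t₀) → χ(u, p, t) → t₀ t₀ ≤ t t`
  let r₀ : (α ⊕ (β ⊕ κ)) ⊕ Fin 1 → V₃ :=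
    Sum.elim (Sum.elim (fun a => Sum.inl (Sum.inl (Sum.inl (Sum.inl a))))
      (fun c => Sum.inl (Sum.inl (Sum.inr c)))) (fun _ => Sum.inr 0)
  let r₁ : (α ⊕ (β ⊕ κ)) ⊕ Fin 1 → V₃ :=
    Sum.elim (Sum.elim (fun a => Sum.inl (Sum.inl (Sum.inl (Sum.inl a))))
      (fun c => Sum.inl (Sum.inr c))) (fun _ => Sum.inr 1)
  let ψ₃ : Language.orderedERing.Formula V₃ :=
    (χ.relabel r₀).imp ((χ.relabel r₁).imp (φr.onFormula
      (LE (Term.var (Sum.inr 0) * Term.var (Sum.inr 0))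
        (Term.var (Sum.inr 1) * Term.var (Sum.inr 1)))))
  -- `p` in the box (variables of `V₂`)
  let Box₂ : Language.orderedRing.Formula V₂ := Formula.iInf fun i : β ⊕ κ =>
    LE (Term.var (Sum.inl (Sum.inl (Sum.inr (Sum.inl i))))) (Term.var (Sum.inr i)) ⊓
      LE (Term.var (Sum.inr i)) (Term.var (Sum.inl (Sum.inl (Sum.inr (Sum.inr i)))))
  let ψ₂ : Language.orderedERing.Formula V₂ := (φr.onFormula Box₂).imp (Formula.iAlls (Fin 2) ψ₃)
  -- `p₀` in the box (variables of `V₁`)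
  let Box₁ : Language.orderedRing.Formula V₁ := Formula.iInf fun i : β ⊕ κ =>
    LE (Term.var (Sum.inl (Sum.inr (Sum.inl i)))) (Term.var (Sum.inr i)) ⊓
      LE (Term.var (Sum.inr i)) (Term.var (Sum.inl (Sum.inr (Sum.inr i))))
  let ψ₁ : Language.orderedERing.Formula V₁ := φr.onFormula Box₁ ⊓ Formula.iAlls (β ⊕ κ) ψ₂
  refine ⟨ψ₁, ?_⟩
  intro M _ _ _ _
  -- the function
  set F : (α → M) → (β ⊕ κ → M) → M := fun u p => MvPolynomial.aeval
    (Sum.elim (Sum.elim u p) (Sum.elim (fun i => EFun.e (u i))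
      (Sum.elim (fun i => EFun.e (p (Sum.inl i)))
        (fun j => if p (Sum.inr j) ^ 2 = 1 then 1
          else EFun.e (p (Sum.inr j) / (1 - p (Sum.inr j) ^ 2)))))) P with hF
  -- `χ` at `z = (u, p)`
  have hχ' : ∀ (u : α → M) (p : β ⊕ κ → M) (t : M),
      χ.Realize (Sum.elim (Sum.elim u p) ![t]) ↔ t = F u p := by
    intro u p t
    rw [hχ M (Sum.elim u p) t]
    rfl
  -- semantics of `ψ₃`
  have hψ₃ : ∀ (u : α → M) (lo hi p₀ p : β ⊕ κ → M) (tt : Fin 2 → M),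
      ψ₃.Realize (Sum.elim (Sum.elim (Sum.elim (Sum.elim u (Sum.elim lo hi)) p₀) p) tt) ↔
        (tt 0 = F u p₀ → tt 1 = F u p → tt 0 * tt 0 ≤ tt 1 * tt 1) := by
    intro u lo hi p₀ p tt
    have hc₀ : (Sum.elim (Sum.elim (Sum.elim (Sum.elim u (Sum.elim lo hi)) p₀) p) tt ∘ r₀) =
        Sum.elim (Sum.elim u p₀) ![tt 0] := by
      funext c; rcases c with (a | c) | k
      · rfl
      · rfl
      · have hk : k = 0 := Subsingleton.elim k 0
        subst hk; rfl
    have hc₁ : (Sum.elim (Sum.elim (Sum.elim (Sum.elim u (Sum.elim lo hi)) p₀) p) tt ∘ r₁) =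
        Sum.elim (Sum.elim u p) ![tt 1] := by
      funext c; rcases c with (a | c) | k
      · rfl
      · rfl
      · have hk : k = 0 := Subsingleton.elim k 0
        subst hk; rfl
    simp only [ψ₃, Formula.realize_imp, Formula.realize_relabel, hc₀, hc₁, hχ',
      LHom.realize_onFormula, LE, realize_termLE, Language.orderedRing.realize_mul,
      Term.realize_var, Sum.elim_inr]
  have hψ₂ : ∀ (u : α → M) (lo hi p₀ p : β ⊕ κ → M),
      ψ₂.Realize (Sum.elim (Sum.elim (Sum.elim u (Sum.elim lo hi)) p₀) p) ↔
        ((∀ i, lo i ≤ p i ∧ p i ≤ hi i) → |F u p₀| ≤ |F u p|) := by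
    intro u lo hi p₀ p
    simp only [ψ₂, Formula.realize_imp, LHom.realize_onFormula, Box₂, Formula.realize_iInf,
      Formula.realize_inf, LE, realize_termLE, Term.realize_var, Sum.elim_inl, Sum.elim_inr,
      Formula.realize_iAlls]
    refine imp_congr Iff.rfl ⟨fun h => ?_, fun h tt => ?_⟩
    · have h' := (hψ₃ u lo hi p₀ p ![F u p₀, F u p]).1 (h _) rfl rfl
      simp only [Matrix.cons_val_zero, Matrix.cons_val_one] at h'
      rw [← abs_mul_abs_self (F u p₀), ← abs_mul_abs_self (F u p)] at h'
      exact (mul_self_le_mul_self_iff (abs_nonneg _) (abs_nonneg _)).2 h'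
    · rw [show (fun a => Sum.elim (Sum.elim (Sum.elim (Sum.elim u (Sum.elim lo hi)) p₀) p) tt a) =
          Sum.elim (Sum.elim (Sum.elim (Sum.elim u (Sum.elim lo hi)) p₀) p) tt from rfl, hψ₃]
      intro h0 h1
      rw [h0, h1, ← abs_mul_abs_self (F u p₀), ← abs_mul_abs_self (F u p)]
      exact (mul_self_le_mul_self_iff (abs_nonneg _) (abs_nonneg _)).1 h
  have hψ₁ : ∀ (u : α → M) (lo hi p₀ : β ⊕ κ → M),
      ψ₁.Realize (Sum.elim (Sum.elim u (Sum.elim lo hi)) p₀) ↔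
        ((∀ i, lo i ≤ p₀ i ∧ p₀ i ≤ hi i) ∧
          ∀ p : β ⊕ κ → M, (∀ i, lo i ≤ p i ∧ p i ≤ hi i) → |F u p₀| ≤ |F u p|) := by
    intro u lo hi p₀
    simp only [ψ₁, Formula.realize_inf, LHom.realize_onFormula, Box₁, Formula.realize_iInf,
      LE, realize_termLE, Term.realize_var, Sum.elim_inl, Sum.elim_inr, Formula.realize_iAlls]
    refine and_congr Iff.rfl ⟨fun h p => ?_, fun h p => ?_⟩
    · have h' := h p
      rw [show (fun a => Sum.elim (Sum.elim (Sum.elim u (Sum.elim lo hi)) p₀) p a) =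
          Sum.elim (Sum.elim (Sum.elim u (Sum.elim lo hi)) p₀) p from rfl, hψ₂] at h'
      exact h'
    · rw [show (fun a => Sum.elim (Sum.elim (Sum.elim u (Sum.elim lo hi)) p₀) p a) =
          Sum.elim (Sum.elim (Sum.elim u (Sum.elim lo hi)) p₀) p from rfl, hψ₂]
      exact h p
  exact fun u lo hi p₀ => hψ₁ u lo hi p₀

/-- **The extreme value sentence**: "for all parameters `u` and all `lo ≤ hi`, `|P(z, e(z), ẽ(z))|`
restricted to `z = (u, p)`, `p` in the box `[lo, hi]`, attains a minimum" is expressed by one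
`L_e`-sentence, uniformly in all ordered fields with `e`. [cite: DenBesten2016, Theorem 7.1.22 (p. 87)] -/
theorem exists_eSentence_isMinOn_box (P : MvPolynomial ((α ⊕ (β ⊕ κ)) ⊕ (α ⊕ (β ⊕ κ))) ℤ) :
    ∃ σ : Language.orderedERing.Sentence,
      ∀ (M : Type) [Field M] [LinearOrder M] [IsStrictOrderedRing M] [EFun M],
        M ⊨ σ ↔ ∀ (u : α → M) (lo hi : β ⊕ κ → M), (∀ i, lo i ≤ hi i) →
          ∃ p₀ : β ⊕ κ → M, (∀ i, lo i ≤ p₀ i ∧ p₀ i ≤ hi i) ∧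
            ∀ p : β ⊕ κ → M, (∀ i, lo i ≤ p i ∧ p i ≤ hi i) →
              |MvPolynomial.aeval
                  (Sum.elim (Sum.elim u p₀) (Sum.elim (fun i => EFun.e (u i))
                    (Sum.elim (fun i => EFun.e (p₀ (Sum.inl i)))
                      (fun j => if p₀ (Sum.inr j) ^ 2 = 1 then 1
                        else EFun.e (p₀ (Sum.inr j) / (1 - p₀ (Sum.inr j) ^ 2)))))) P| ≤
              |MvPolynomial.aeval
                  (Sum.elim (Sum.elim u p) (Sum.elim (fun i => EFun.e (u i))
                    (Sum.elim (fun i => EFun.e (p (Sum.inl i)))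
                      (fun j => if p (Sum.inr j) ^ 2 = 1 then 1
                        else EFun.e (p (Sum.inr j) / (1 - p (Sum.inr j) ^ 2)))))) P| := by
  classical
  obtain ⟨ψ₁, hψ₁⟩ := exists_eFormula_isMinOn_box P
  let φr : Language.orderedRing →ᴸ Language.orderedERing := LHom.sumInl
  let LE : ∀ {V : Type}, Language.orderedRing.Term V → Language.orderedRing.Term V →
      Language.orderedRing.Formula V := fun t₁ t₂ => (t₁.relabel Sum.inl).le (t₂.relabel Sum.inl)
  let U := α ⊕ ((β ⊕ κ) ⊕ (β ⊕ κ))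
  -- `lo ≤ hi` (variables of `U`)
  let Box₀ : Language.orderedRing.Formula U := Formula.iInf fun i : β ⊕ κ =>
    LE (Term.var (Sum.inr (Sum.inl i))) (Term.var (Sum.inr (Sum.inr i)))
  let ψ₀ : Language.orderedERing.Formula U := (φr.onFormula Box₀).imp (Formula.iExs (β ⊕ κ) ψ₁)
  refine ⟨Formula.iAlls U (ψ₀.relabel Sum.inr), ?_⟩
  intro M _ _ _ _
  set F : (α → M) → (β ⊕ κ → M) → M := fun u p => MvPolynomial.aeval
    (Sum.elim (Sum.elim u p) (Sum.elim (fun i => EFun.e (u i))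
      (Sum.elim (fun i => EFun.e (p (Sum.inl i)))
        (fun j => if p (Sum.inr j) ^ 2 = 1 then 1
          else EFun.e (p (Sum.inr j) / (1 - p (Sum.inr j) ^ 2)))))) P with hF
  have hψ₁' : ∀ (u : α → M) (lo hi p₀ : β ⊕ κ → M),
      ψ₁.Realize (Sum.elim (Sum.elim u (Sum.elim lo hi)) p₀) ↔
        ((∀ i, lo i ≤ p₀ i ∧ p₀ i ≤ hi i) ∧
          ∀ p : β ⊕ κ → M, (∀ i, lo i ≤ p i ∧ p i ≤ hi i) → |F u p₀| ≤ |F u p|) :=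
    fun u lo hi p₀ => hψ₁ M u lo hi p₀
  have hψ₀ : ∀ (u : α → M) (lo hi : β ⊕ κ → M),
      ψ₀.Realize (Sum.elim u (Sum.elim lo hi)) ↔
        ((∀ i, lo i ≤ hi i) → ∃ p₀ : β ⊕ κ → M, (∀ i, lo i ≤ p₀ i ∧ p₀ i ≤ hi i) ∧
          ∀ p : β ⊕ κ → M, (∀ i, lo i ≤ p i ∧ p i ≤ hi i) → |F u p₀| ≤ |F u p|) := by
    intro u lo hi
    simp only [ψ₀, Formula.realize_imp, LHom.realize_onFormula, Box₀, Formula.realize_iInf,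
      LE, realize_termLE, Term.realize_var, Sum.elim_inl, Sum.elim_inr, Formula.realize_iExs,
      hψ₁']
  -- the sentence
  have hσ : (M ⊨ Formula.iAlls U (ψ₀.relabel Sum.inr)) ↔
      ∀ w : U → M, ψ₀.Realize w := by
    show Formula.Realize (Formula.iAlls U (ψ₀.relabel Sum.inr)) (default : Empty → M) ↔ _
    simp only [Formula.realize_iAlls, Formula.realize_relabel]
    refine forall_congr' fun w => ?_
    rw [show ((fun a => Sum.elim (default : Empty → M) w a) ∘ Sum.inr) = w from rfl]
  rw [hσ]
  constructor
  · intro h u lo hi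
    have h' := h (Sum.elim u (Sum.elim lo hi))
    rw [hψ₀] at h'
    exact h'
  · intro h w
    have hw : w = Sum.elim (w ∘ Sum.inl) (Sum.elim (w ∘ Sum.inr ∘ Sum.inl) (w ∘ Sum.inr ∘ Sum.inr)) := by
      funext c; rcases c with a | i | i <;> rfl
    rw [hw, hψ₀]
    exact h _ _ _

/-- **The extreme value sentence holds in `ℝ`** (closed boxes are compact; `F` is continuous).
[folklore] -/
theorem real_models_isMinOn_box (P : MvPolynomial ((α ⊕ (β ⊕ κ)) ⊕ (α ⊕ (β ⊕ κ))) ℤ)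
    (u : α → ℝ) (lo hi : β ⊕ κ → ℝ) (hle : ∀ i, lo i ≤ hi i) :
    ∃ p₀ : β ⊕ κ → ℝ, (∀ i, lo i ≤ p₀ i ∧ p₀ i ≤ hi i) ∧
      ∀ p : β ⊕ κ → ℝ, (∀ i, lo i ≤ p i ∧ p i ≤ hi i) →
        |MvPolynomial.aeval
            (Sum.elim (Sum.elim u p₀) (Sum.elim (fun i => EFun.e (u i))
              (Sum.elim (fun i => EFun.e (p₀ (Sum.inl i)))
                (fun j => if p₀ (Sum.inr j) ^ 2 = 1 then (1 : ℝ)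
                  else EFun.e (p₀ (Sum.inr j) / (1 - p₀ (Sum.inr j) ^ 2)))))) P| ≤
        |MvPolynomial.aeval
            (Sum.elim (Sum.elim u p) (Sum.elim (fun i => EFun.e (u i))
              (Sum.elim (fun i => EFun.e (p (Sum.inl i)))
                (fun j => if p (Sum.inr j) ^ 2 = 1 then (1 : ℝ)
                  else EFun.e (p (Sum.inr j) / (1 - p (Sum.inr j) ^ 2)))))) P| := by
  classical
  -- `F(u, p)` as the composition of the analytic function of `z` with `p ↦ (u, p)`
  set G : (α ⊕ (β ⊕ κ) → ℝ) → ℝ := fun z => MvPolynomial.aeval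
    (Sum.elim z (Sum.elim (fun i => EFun.e (z (Sum.inl i)))
      (Sum.elim (fun i => EFun.e (z (Sum.inr (Sum.inl i))))
        (fun j => if z (Sum.inr (Sum.inr j)) ^ 2 = 1 then (1 : ℝ)
          else EFun.e (z (Sum.inr (Sum.inr j)) / (1 - z (Sum.inr (Sum.inr j)) ^ 2)))))) P
    with hG
  have hGc : Continuous G := continuous_iff_continuousAt.2 fun z => (analyticAt_aeval_e P z).continuousAt
  have hemb : Continuous fun p : β ⊕ κ → ℝ => (Sum.elim u p : α ⊕ (β ⊕ κ) → ℝ) := by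
    refine continuous_pi fun c => ?_
    rcases c with a | c
    · exact continuous_const
    · exact continuous_apply c
  have hFc : Continuous fun p : β ⊕ κ → ℝ => |G (Sum.elim u p)| :=
    (hGc.comp hemb).abs
  have hcpt : IsCompact (Set.Icc lo hi) := isCompact_Icc
  have hne : (Set.Icc lo hi).Nonempty := ⟨lo, le_rfl, fun i => hle i⟩
  obtain ⟨p₀, hp₀, hmin⟩ := hcpt.exists_isMinOn hne hFc.continuousOn
  refine ⟨p₀, fun i => ⟨hp₀.1 i, hp₀.2 i⟩, fun p hp => ?_⟩
  have h := hmin (show p ∈ Set.Icc lo hi from ⟨fun i => (hp i).1, fun i => (hp i).2⟩)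
  exact h

/-- **`|P(z, e(z), ẽ(z))|` attains its minimum on every closed box of every model of `T_exp`**
(den Besten 2016, proof of Theorem 7.1.22, p. 87: "By transfer of the Extreme Value Theorem to
`K`, `h` must attain a minimum on the set … as this set is closed, bounded and definable"), by
transfer of `exists_eSentence_isMinOn_box` from `ℝ`. [cite: DenBesten2016, Theorem 7.1.22 (p. 87)] -/
theorem exists_isMinOn_box (P : MvPolynomial ((α ⊕ (β ⊕ κ)) ⊕ (α ⊕ (β ⊕ κ))) ℤ)
    (K : Language.Theory.ModelType.{0, 0, 0} realExpTheory) (u : α → K) (lo hi : β ⊕ κ → K)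
    (hle : ∀ i, lo i ≤ hi i) :
    ∃ p₀ : β ⊕ κ → K, (∀ i, lo i ≤ p₀ i ∧ p₀ i ≤ hi i) ∧
      ∀ p : β ⊕ κ → K, (∀ i, lo i ≤ p i ∧ p i ≤ hi i) →
        |MvPolynomial.aeval
            (Sum.elim (Sum.elim u p₀) (Sum.elim (fun i => EFun.e (u i))
              (Sum.elim (fun i => EFun.e (p₀ (Sum.inl i)))
                (fun j => if p₀ (Sum.inr j) ^ 2 = 1 then 1
                  else EFun.e (p₀ (Sum.inr j) / (1 - p₀ (Sum.inr j) ^ 2)))))) P| ≤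
        |MvPolynomial.aeval
            (Sum.elim (Sum.elim u p) (Sum.elim (fun i => EFun.e (u i))
              (Sum.elim (fun i => EFun.e (p (Sum.inl i)))
                (fun j => if p (Sum.inr j) ^ 2 = 1 then 1
                  else EFun.e (p (Sum.inr j) / (1 - p (Sum.inr j) ^ 2)))))) P| := by
  obtain ⟨σ, hσ⟩ := exists_eSentence_isMinOn_box P
  have hR : ℝ ⊨ σ := (hσ ℝ).2 fun u lo hi hle => real_models_isMinOn_box P u lo hi hle
  have hK : (K : Type) ⊨ σ := (RealExpModel.realize_eSentence_iff_real K σ).2 hR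
  exact (hσ K).1 hK u lo hi hle

end ExtremeValue

/-! ### Taylor approximation, transferred to the models of `T_exp` -/

section Taylor

/-- `t₁ < t₂` as a formula of the language of ordered rings, with its meaning. [folklore] -/
theorem realize_termLT {V : Type*} (t₁ t₂ : Language.orderedRing.Term V) (M : Type) [Field M]
    [LinearOrder M] (v : V → M) :
    Formula.Realize ((t₁.relabel Sum.inl).lt (t₂.relabel Sum.inl) :
      Language.orderedRing.Formula V) v ↔ t₁.realize v < t₂.realize v := by
  show BoundedFormula.Realize _ v default ↔ _
  rw [Term.realize_lt]
  simp [Term.realize_relabel]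

variable {α β κ : Type} [Fintype α] [Fintype β] [Fintype κ]

/-- **Analytic functions are approximated by polynomials to any order, locally** (Taylor
expansion with remainder, den Besten's (40), p. 88 — here from the power series of the analytic
function `p ↦ P((u, p), e, ẽ)` at `ω`, Mathlib's `HasFPowerSeriesOnBall.uniform_geometric_approx`;
the Taylor polynomial of degree `deg` is presented as `Σ_{k ≤ λ, j : Fin k → β ⊕ κ} c_{k,j} Πₗ (p_{jₗ} - ω_{jₗ})`).
[cite: DenBesten2016, Theorem 7.1.22 (40)] -/
theorem real_taylor (P : MvPolynomial ((α ⊕ (β ⊕ κ)) ⊕ (α ⊕ (β ⊕ κ))) ℤ) (deg : ℕ)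
    (u : α → ℝ) (ω : β ⊕ κ → ℝ) :
    ∃ (r₀ : ℝ) (c : (Σ k : Fin (deg + 1), (Fin k → β ⊕ κ)) → ℝ) (B : ℝ), 0 < r₀ ∧ 0 ≤ B ∧
      ∀ t : ℝ, 0 < t → t < r₀ → ∀ p : β ⊕ κ → ℝ, (∀ i, |p i - ω i| < t) →
        |MvPolynomial.aeval
            (Sum.elim (Sum.elim u p) (Sum.elim (fun i => EFun.e (u i))
              (Sum.elim (fun i => EFun.e (p (Sum.inl i)))
                (fun j => if p (Sum.inr j) ^ 2 = 1 then (1 : ℝ)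
                  else EFun.e (p (Sum.inr j) / (1 - p (Sum.inr j) ^ 2)))))) P -
          ∑ ki, c ki * ∏ l, (p (ki.2 l) - ω (ki.2 l))| ≤ B * t ^ (deg + 1) := by
  classical
  set G : (α ⊕ (β ⊕ κ) → ℝ) → ℝ := fun z => MvPolynomial.aeval
    (Sum.elim z (Sum.elim (fun i => EFun.e (z (Sum.inl i)))
      (Sum.elim (fun i => EFun.e (z (Sum.inr (Sum.inl i))))
        (fun j => if z (Sum.inr (Sum.inr j)) ^ 2 = 1 then (1 : ℝ)
          else EFun.e (z (Sum.inr (Sum.inr j)) / (1 - z (Sum.inr (Sum.inr j)) ^ 2)))))) P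
    with hG
  set f : (β ⊕ κ → ℝ) → ℝ := fun p => G (Sum.elim u p) with hf
  -- `f` is analytic at `ω`
  have hemb : AnalyticAt ℝ (fun p : β ⊕ κ → ℝ => (Sum.elim u p : α ⊕ (β ⊕ κ) → ℝ)) ω := by
    refine analyticAt_pi_iff.2 fun c => ?_
    rcases c with a | c
    · exact analyticAt_const
    · exact (ContinuousLinearMap.proj (R := ℝ) (φ := fun _ : β ⊕ κ => ℝ) c).analyticAt ω
  have hfa : AnalyticAt ℝ f ω := (analyticAt_aeval_e P (Sum.elim u ω)).comp hemb
  obtain ⟨q, r, hq⟩ : ∃ (q : FormalMultilinearSeries ℝ (β ⊕ κ → ℝ) ℝ) (r : ENNReal),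
      HasFPowerSeriesOnBall f q ω r := by
    obtain ⟨q, hq⟩ := hfa
    obtain ⟨r, hr⟩ := hq
    exact ⟨q, r, hr⟩
  obtain ⟨r', hr'0, hr'r⟩ := ENNReal.lt_iff_exists_nnreal_btwn.1 hq.r_pos
  have hr'pos : (0 : ℝ) < r' := by exact_mod_cast hr'0
  obtain ⟨a, ha, C, hC, happ⟩ := hq.uniform_geometric_approx' hr'r
  -- the coefficients of the Taylor polynomial of degree `deg`
  let c : (Σ k : Fin (deg + 1), (Fin k → β ⊕ κ)) → ℝ := fun ki =>
    q ki.1 fun l => Pi.single (ki.2 l) 1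
  have hpoly : ∀ y : β ⊕ κ → ℝ,
      q.partialSum (deg + 1) y = ∑ ki, c ki * ∏ l, y (ki.2 l) := by
    intro y
    have hk : ∀ k : ℕ, (q k fun _ => y) =
        ∑ j : Fin k → β ⊕ κ, (∏ l, y (j l)) * q k fun l => Pi.single (j l) 1 := by
      intro k
      have hy : (fun _ : Fin k => y) = fun _ => ∑ i, y i • (Pi.single i 1 : β ⊕ κ → ℝ) := by
        funext l
        conv_lhs => rw [← Finset.univ_sum_single y]
        refine Finset.sum_congr rfl fun i _ => ?_
        rw [← Pi.single_smul', smul_eq_mul, mul_one]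
      rw [hy, ContinuousMultilinearMap.map_sum_finset]
      simp only [Fintype.piFinset_univ]
      refine Finset.sum_congr rfl fun j _ => ?_
      rw [ContinuousMultilinearMap.map_smul_univ, smul_eq_mul]
    rw [FormalMultilinearSeries.partialSum, Finset.sum_range, Fintype.sum_sigma]
    refine Finset.sum_congr rfl fun k _ => ?_
    rw [hk]
    refine Finset.sum_congr rfl fun j _ => ?_
    rw [mul_comm]
  refine ⟨r', c, C * (a / r') ^ (deg + 1), hr'pos, ?_, ?_⟩
  · exact mul_nonneg hC.le (pow_nonneg (div_nonneg ha.1.le hr'pos.le) _)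
  intro t ht htr p hp
  set y : β ⊕ κ → ℝ := p - ω with hy
  have hynorm : ‖y‖ < t := by
    rw [pi_norm_lt_iff ht]
    intro i
    rw [Real.norm_eq_abs]
    exact hp i
  have hyball : y ∈ Metric.ball (0 : β ⊕ κ → ℝ) r' := by
    rw [Metric.mem_ball, dist_zero_right]
    exact hynorm.trans htr
  have h := happ y hyball (deg + 1)
  have hfy : f (ω + y) = G (Sum.elim u p) := by
    rw [hy, add_sub_cancel]
  rw [hfy, hpoly y, Real.norm_eq_abs] at h
  have hyeq : ∀ ki : (Σ k : Fin (deg + 1), (Fin k → β ⊕ κ)), (∏ l, y (ki.2 l)) =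
      ∏ l, (p (ki.2 l) - ω (ki.2 l)) := fun ki => by
    simp [hy]
  simp only [hyeq] at h
  refine h.trans ?_
  have h1 : a * (‖y‖ / r') ≤ a * (t / r') := by gcongr; exact ha.1.le
  have h0 : 0 ≤ a * (‖y‖ / r') := mul_nonneg ha.1.le (div_nonneg (norm_nonneg _) hr'pos.le)
  calc C * (a * (‖y‖ / r')) ^ (deg + 1) ≤ C * (a * (t / r')) ^ (deg + 1) := by gcongr
    _ = C * (a / r') ^ (deg + 1) * t ^ (deg + 1) := by rw [show a * (t / r') = a / r' * t by ring, mul_pow]; ring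

/-- **The Taylor-bound formula of order `deg`**: "`0 < r₀`, `0 ≤ B`, and
`|F(u, p) - Σ c_{k,j} Π (p_{jₗ} - ω_{jₗ})| ≤ B t^{deg+1}` whenever `0 < t < r₀` and
`‖p - ω‖ < t`", in the variables `(u, ω; r₀, B, c)`, is one `L_e`-formula, uniformly in all
ordered fields with `e`. [cite: DenBesten2016, Theorem 7.1.22 (40)] -/
theorem exists_eFormula_taylor (P : MvPolynomial ((α ⊕ (β ⊕ κ)) ⊕ (α ⊕ (β ⊕ κ))) ℤ) (deg : ℕ) :
    ∃ ψ : Language.orderedERing.Formula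
        ((α ⊕ (β ⊕ κ)) ⊕ (Fin 2 ⊕ (Σ k : Fin (deg + 1), (Fin k → β ⊕ κ)))),
      ∀ (M : Type) [Field M] [LinearOrder M] [IsStrictOrderedRing M] [EFun M]
        (u : α → M) (ω : β ⊕ κ → M) (rB : Fin 2 → M)
        (c : (Σ k : Fin (deg + 1), (Fin k → β ⊕ κ)) → M),
        ψ.Realize (Sum.elim (Sum.elim u ω) (Sum.elim rB c)) ↔
          ((0 < rB 0 ∧ 0 ≤ rB 1) ∧
            ∀ t : M, 0 < t → t < rB 0 → ∀ p : β ⊕ κ → M, (∀ i, |p i - ω i| < t) →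
              |MvPolynomial.aeval
                  (Sum.elim (Sum.elim u p) (Sum.elim (fun i => EFun.e (u i))
                    (Sum.elim (fun i => EFun.e (p (Sum.inl i)))
                      (fun j => if p (Sum.inr j) ^ 2 = 1 then 1
                        else EFun.e (p (Sum.inr j) / (1 - p (Sum.inr j) ^ 2)))))) P -
                ∑ ki, c ki * ∏ l, (p (ki.2 l) - ω (ki.2 l))| ≤ rB 1 * t ^ (deg + 1)) := by
  classical
  obtain ⟨χ, hχ⟩ := exists_eFormula_graph P
  let φr : Language.orderedRing →ᴸ Language.orderedERing := LHom.sumInl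
  let LE : ∀ {V : Type}, Language.orderedRing.Term V → Language.orderedRing.Term V →
      Language.orderedRing.Formula V := fun t₁ t₂ => (t₁.relabel Sum.inl).le (t₂.relabel Sum.inl)
  let LT : ∀ {V : Type}, Language.orderedRing.Term V → Language.orderedRing.Term V →
      Language.orderedRing.Formula V := fun t₁ t₂ => (t₁.relabel Sum.inl).lt (t₂.relabel Sum.inl)
  -- coefficient indices and variable blocks
  let CI := Σ k : Fin (deg + 1), (Fin k → β ⊕ κ)
  let U := α ⊕ (β ⊕ κ)                    -- `u, ω`
  let E := Fin 2 ⊕ CI                      -- `r₀, B, c`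
  let A := Fin 1 ⊕ (β ⊕ κ)                 -- `t, p`
  let W₂ := (U ⊕ E) ⊕ A
  let W₃ := W₂ ⊕ Fin 1                     -- `v`
  -- the Taylor polynomial as an integer polynomial in the variables `(c, p, ω)`
  let Q : MvPolynomial (CI ⊕ ((β ⊕ κ) ⊕ (β ⊕ κ))) ℤ :=
    ∑ ki : CI, MvPolynomial.X (Sum.inl ki) *
      ∏ l, (MvPolynomial.X (Sum.inr (Sum.inl (ki.2 l))) - MvPolynomial.X (Sum.inr (Sum.inr (ki.2 l))))
  have hQ : ∀ (M : Type) [CommRing M] (c : CI → M) (p ω : β ⊕ κ → M),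
      MvPolynomial.aeval (Sum.elim c (Sum.elim p ω)) Q = ∑ ki, c ki * ∏ l, (p (ki.2 l) - ω (ki.2 l)) := by
    intro M _ c p ω
    simp only [Q, map_sum, map_mul, map_prod, map_sub, MvPolynomial.aeval_X, Sum.elim_inl,
      Sum.elim_inr]
  obtain ⟨tQ, htQ⟩ := exists_term_realize_eq_aeval Q
  obtain ⟨tpow, htpow⟩ := exists_term_pow (Sum.inl (Sum.inr (Sum.inl 0)) : W₃) (deg + 1)
  -- innermost: `χ(u, p, v) → (v - Q)² ≤ (B t^{deg+1})²`
  let rχ : (α ⊕ (β ⊕ κ)) ⊕ Fin 1 → W₃ :=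
    Sum.elim (Sum.elim (fun a => Sum.inl (Sum.inl (Sum.inl (Sum.inl a))))
      (fun i => Sum.inl (Sum.inr (Sum.inr i)))) (fun _ => Sum.inr 0)
  let rQ : CI ⊕ ((β ⊕ κ) ⊕ (β ⊕ κ)) → W₃ :=
    Sum.elim (fun ki => Sum.inl (Sum.inl (Sum.inr (Sum.inr ki))))
      (Sum.elim (fun i => Sum.inl (Sum.inr (Sum.inr i))) (fun i => Sum.inl (Sum.inl (Sum.inl (Sum.inr i)))))
  let vT : Language.orderedRing.Term W₃ := Term.var (Sum.inr 0)
  let BT : Language.orderedRing.Term W₃ := Term.var (Sum.inl (Sum.inl (Sum.inr (Sum.inl 1))))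
  let ψ₃ : Language.orderedERing.Formula W₃ :=
    (χ.relabel rχ).imp (φr.onFormula
      (LE ((vT + -(tQ.relabel rQ)) * (vT + -(tQ.relabel rQ))) ((BT * tpow) * (BT * tpow))))
  -- `0 < t < r₀` and `‖p - ω‖ < t` (variables of `W₂`)
  let tT : Language.orderedRing.Term W₂ := Term.var (Sum.inr (Sum.inl 0))
  let r₀T : Language.orderedRing.Term W₂ := Term.var (Sum.inl (Sum.inr (Sum.inl 0)))
  let pT : β ⊕ κ → Language.orderedRing.Term W₂ := fun i => Term.var (Sum.inr (Sum.inr i))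
  let ωT : β ⊕ κ → Language.orderedRing.Term W₂ := fun i => Term.var (Sum.inl (Sum.inl (Sum.inr i)))
  let Cond : Language.orderedRing.Formula W₂ :=
    (LT 0 tT ⊓ LT tT r₀T) ⊓ Formula.iInf fun i : β ⊕ κ =>
      LT (pT i + -(ωT i)) tT ⊓ LT (ωT i + -(pT i)) tT
  let ψ₂ : Language.orderedERing.Formula W₂ := (φr.onFormula Cond).imp (Formula.iAlls (Fin 1) ψ₃)
  -- `0 < r₀ ∧ 0 ≤ B` (variables of `U ⊕ E`)
  let Pos : Language.orderedRing.Formula (U ⊕ E) :=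
    LT 0 (Term.var (Sum.inr (Sum.inl 0))) ⊓ LE 0 (Term.var (Sum.inr (Sum.inl 1)))
  let ψ₁ : Language.orderedERing.Formula (U ⊕ E) := φr.onFormula Pos ⊓ Formula.iAlls A ψ₂
  refine ⟨ψ₁, ?_⟩
  intro M _ _ _ _
  set F : (α → M) → (β ⊕ κ → M) → M := fun u p => MvPolynomial.aeval
    (Sum.elim (Sum.elim u p) (Sum.elim (fun i => EFun.e (u i))
      (Sum.elim (fun i => EFun.e (p (Sum.inl i)))
        (fun j => if p (Sum.inr j) ^ 2 = 1 then 1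
          else EFun.e (p (Sum.inr j) / (1 - p (Sum.inr j) ^ 2)))))) P with hF
  have hχ' : ∀ (u : α → M) (p : β ⊕ κ → M) (v : M),
      χ.Realize (Sum.elim (Sum.elim u p) ![v]) ↔ v = F u p := by
    intro u p v
    rw [hχ M (Sum.elim u p) v]
    rfl
  -- valuations: `w = ((u, ω), (rB, c))`, then `(t, p)`, then `v`
  have hψ₃ : ∀ (u : α → M) (ω : β ⊕ κ → M) (rB : Fin 2 → M) (c : CI → M) (tt : Fin 1 → M)
      (p : β ⊕ κ → M) (vv : Fin 1 → M),
      ψ₃.Realize (Sum.elim (Sum.elim (Sum.elim (Sum.elim u ω) (Sum.elim rB c)) (Sum.elim tt p)) vv) ↔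
        (vv 0 = F u p →
          (vv 0 - ∑ ki, c ki * ∏ l, (p (ki.2 l) - ω (ki.2 l))) *
            (vv 0 - ∑ ki, c ki * ∏ l, (p (ki.2 l) - ω (ki.2 l))) ≤
          (rB 1 * tt 0 ^ (deg + 1)) * (rB 1 * tt 0 ^ (deg + 1))) := by
    intro u ω rB c tt p vv
    have hcχ : (Sum.elim (Sum.elim (Sum.elim (Sum.elim u ω) (Sum.elim rB c)) (Sum.elim tt p)) vv ∘ rχ) =
        Sum.elim (Sum.elim u p) ![vv 0] := by
      funext x; rcases x with (a | i) | k
      · rfl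
      · rfl
      · have hk : k = 0 := Subsingleton.elim k 0
        subst hk; rfl
    have hcQ : (Sum.elim (Sum.elim (Sum.elim (Sum.elim u ω) (Sum.elim rB c)) (Sum.elim tt p)) vv ∘ rQ) =
        Sum.elim c (Sum.elim p ω) := by
      funext x; rcases x with ki | i | i <;> rfl
    simp only [ψ₃, Formula.realize_imp, Formula.realize_relabel, hcχ, hχ', LHom.realize_onFormula,
      LE, realize_termLE, Language.orderedRing.realize_mul, Language.orderedRing.realize_add, Language.orderedRing.realize_neg,
      Term.realize_var, Term.realize_relabel, hcQ, htQ, hQ, htpow, vT, BT, Sum.elim_inl,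
      Sum.elim_inr, ← sub_eq_add_neg]
  have hψ₂ : ∀ (u : α → M) (ω : β ⊕ κ → M) (rB : Fin 2 → M) (c : CI → M) (tt : Fin 1 → M)
      (p : β ⊕ κ → M),
      ψ₂.Realize (Sum.elim (Sum.elim (Sum.elim u ω) (Sum.elim rB c)) (Sum.elim tt p)) ↔
        ((0 < tt 0 ∧ tt 0 < rB 0) ∧ (∀ i, p i - ω i < tt 0 ∧ ω i - p i < tt 0) →
          |F u p - ∑ ki, c ki * ∏ l, (p (ki.2 l) - ω (ki.2 l))| ≤ |rB 1 * tt 0 ^ (deg + 1)|) := by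
    intro u ω rB c tt p
    simp only [ψ₂, Formula.realize_imp, LHom.realize_onFormula, Cond, Formula.realize_inf,
      Formula.realize_iInf, LT, realize_termLT, Language.orderedRing.realize_add, Language.orderedRing.realize_neg,
      Language.orderedRing.realize_zero, Term.realize_var, tT, r₀T, pT, ωT, Sum.elim_inl,
      Sum.elim_inr, Formula.realize_iAlls, ← sub_eq_add_neg]
    refine imp_congr Iff.rfl ⟨fun h => ?_, fun h vv => ?_⟩
    · have h' := (hψ₃ u ω rB c tt p ![F u p]).1 (h _) rfl
      simp only [Matrix.cons_val_zero] at h'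
      rw [← abs_mul_abs_self, ← abs_mul_abs_self (rB 1 * tt 0 ^ (deg + 1))] at h'
      exact (mul_self_le_mul_self_iff (abs_nonneg _) (abs_nonneg _)).2 h'
    · rw [show (fun a => Sum.elim (Sum.elim (Sum.elim (Sum.elim u ω) (Sum.elim rB c))
          (Sum.elim tt p)) vv a) =
          Sum.elim (Sum.elim (Sum.elim (Sum.elim u ω) (Sum.elim rB c)) (Sum.elim tt p)) vv
          from rfl, hψ₃]
      intro h0
      rw [h0]
      have h' := (mul_self_le_mul_self_iff (abs_nonneg _) (abs_nonneg _)).1 h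
      rwa [abs_mul_abs_self, abs_mul_abs_self] at h'
  have hψ₁ : ∀ (u : α → M) (ω : β ⊕ κ → M) (rB : Fin 2 → M) (c : CI → M),
      ψ₁.Realize (Sum.elim (Sum.elim u ω) (Sum.elim rB c)) ↔
        ((0 < rB 0 ∧ 0 ≤ rB 1) ∧ ∀ (tt : Fin 1 → M) (p : β ⊕ κ → M),
          ((0 < tt 0 ∧ tt 0 < rB 0) ∧ (∀ i, p i - ω i < tt 0 ∧ ω i - p i < tt 0) →
            |F u p - ∑ ki, c ki * ∏ l, (p (ki.2 l) - ω (ki.2 l))| ≤ |rB 1 * tt 0 ^ (deg + 1)|)) := by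
    intro u ω rB c
    simp only [ψ₁, Formula.realize_inf, LHom.realize_onFormula, Pos, LT, LE, realize_termLT,
      realize_termLE, Language.orderedRing.realize_zero, Term.realize_var, Sum.elim_inl,
      Sum.elim_inr, Formula.realize_iAlls]
    refine and_congr Iff.rfl ⟨fun h tt p => ?_, fun h tp => ?_⟩
    · have h' := h (Sum.elim tt p)
      rw [show (fun a => Sum.elim (Sum.elim (Sum.elim u ω) (Sum.elim rB c)) (Sum.elim tt p) a) =
          Sum.elim (Sum.elim (Sum.elim u ω) (Sum.elim rB c)) (Sum.elim tt p) from rfl, hψ₂] at h'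
      exact h'
    · have htp : tp = Sum.elim (tp ∘ Sum.inl) (tp ∘ Sum.inr) := by
        funext x; rcases x with x | x <;> rfl
      rw [show (fun a => Sum.elim (Sum.elim (Sum.elim u ω) (Sum.elim rB c)) tp a) =
          Sum.elim (Sum.elim (Sum.elim u ω) (Sum.elim rB c)) tp from rfl, htp, hψ₂]
      exact h _ _
  intro u ω rB c
  rw [hψ₁]
  constructor
  · rintro ⟨⟨hr, hB⟩, h⟩
    refine ⟨⟨hr, hB⟩, fun t ht htr p hp => ?_⟩
    have h' := h ![t] p ⟨⟨ht, htr⟩, fun i => abs_sub_lt_iff.1 (hp i)⟩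
    simp only [Matrix.cons_val_zero] at h'
    rwa [abs_of_nonneg (mul_nonneg hB (pow_nonneg ht.le _))] at h'
  · rintro ⟨⟨hr, hB⟩, h⟩
    refine ⟨⟨hr, hB⟩, fun tt p hcond => ?_⟩
    have h' := h (tt 0) hcond.1.1 hcond.1.2 p (fun i => abs_sub_lt_iff.2 (hcond.2 i))
    rwa [abs_of_nonneg (mul_nonneg hB (pow_nonneg hcond.1.1.le _))]

/-- **The Taylor sentence of order `deg`**: "for all `u, ω` there are `r₀ > 0`, coefficients `c` and
`B ≥ 0` with `|F(u, p) - Σ c_{k,j} Π (p_{jₗ} - ω_{jₗ})| ≤ B t^{deg+1}` whenever `0 < t < r₀` and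
`‖p - ω‖ < t`" is one `L_e`-sentence, uniformly in all ordered fields with `e`.
[cite: DenBesten2016, Theorem 7.1.22 (40)] -/
theorem exists_eSentence_taylor (P : MvPolynomial ((α ⊕ (β ⊕ κ)) ⊕ (α ⊕ (β ⊕ κ))) ℤ) (deg : ℕ) :
    ∃ σ : Language.orderedERing.Sentence,
      ∀ (M : Type) [Field M] [LinearOrder M] [IsStrictOrderedRing M] [EFun M],
        M ⊨ σ ↔ ∀ (u : α → M) (ω : β ⊕ κ → M),
          ∃ (r₀ : M) (c : (Σ k : Fin (deg + 1), (Fin k → β ⊕ κ)) → M) (B : M), 0 < r₀ ∧ 0 ≤ B ∧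
            ∀ t : M, 0 < t → t < r₀ → ∀ p : β ⊕ κ → M, (∀ i, |p i - ω i| < t) →
              |MvPolynomial.aeval
                  (Sum.elim (Sum.elim u p) (Sum.elim (fun i => EFun.e (u i))
                    (Sum.elim (fun i => EFun.e (p (Sum.inl i)))
                      (fun j => if p (Sum.inr j) ^ 2 = 1 then 1
                        else EFun.e (p (Sum.inr j) / (1 - p (Sum.inr j) ^ 2)))))) P -
                ∑ ki, c ki * ∏ l, (p (ki.2 l) - ω (ki.2 l))| ≤ B * t ^ (deg + 1) := by
  classical
  obtain ⟨ψ₁, hψ₁⟩ := exists_eFormula_taylor P deg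
  let CI := Σ k : Fin (deg + 1), (Fin k → β ⊕ κ)
  let U := α ⊕ (β ⊕ κ)
  let E := Fin 2 ⊕ CI
  let ψ₀ : Language.orderedERing.Formula U := Formula.iExs E ψ₁
  refine ⟨Formula.iAlls U (ψ₀.relabel Sum.inr), ?_⟩
  intro M _ _ _ _
  set F : (α → M) → (β ⊕ κ → M) → M := fun u p => MvPolynomial.aeval
    (Sum.elim (Sum.elim u p) (Sum.elim (fun i => EFun.e (u i))
      (Sum.elim (fun i => EFun.e (p (Sum.inl i)))
        (fun j => if p (Sum.inr j) ^ 2 = 1 then 1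
          else EFun.e (p (Sum.inr j) / (1 - p (Sum.inr j) ^ 2)))))) P with hF
  have hψ₀ : ∀ (u : α → M) (ω : β ⊕ κ → M),
      ψ₀.Realize (Sum.elim u ω) ↔ ∃ (rB : Fin 2 → M) (c : CI → M),
        (0 < rB 0 ∧ 0 ≤ rB 1) ∧
          ∀ t : M, 0 < t → t < rB 0 → ∀ p : β ⊕ κ → M, (∀ i, |p i - ω i| < t) →
            |F u p - ∑ ki, c ki * ∏ l, (p (ki.2 l) - ω (ki.2 l))| ≤ rB 1 * t ^ (deg + 1) := by
    intro u ω
    simp only [ψ₀, Formula.realize_iExs]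
    constructor
    · rintro ⟨w, hw⟩
      have hw' : w = Sum.elim (w ∘ Sum.inl) (w ∘ Sum.inr) := by
        funext x; rcases x with x | x <;> rfl
      rw [hw', hψ₁ M] at hw
      exact ⟨_, _, hw⟩
    · rintro ⟨rB, c, h⟩
      exact ⟨Sum.elim rB c, (hψ₁ M u ω rB c).2 h⟩
  have hσ : (M ⊨ Formula.iAlls U (ψ₀.relabel Sum.inr)) ↔ ∀ w : U → M, ψ₀.Realize w := by
    show Formula.Realize (Formula.iAlls U (ψ₀.relabel Sum.inr)) (default : Empty → M) ↔ _
    simp only [Formula.realize_iAlls, Formula.realize_relabel]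
    refine forall_congr' fun w => ?_
    rw [show ((fun a => Sum.elim (default : Empty → M) w a) ∘ Sum.inr) = w from rfl]
  rw [hσ]
  constructor
  · intro h u ω
    have h' := h (Sum.elim u ω)
    rw [hψ₀] at h'
    obtain ⟨rB, c, ⟨hr, hB⟩, h''⟩ := h'
    exact ⟨rB 0, c, rB 1, hr, hB, h''⟩
  · intro h w
    have hw : w = Sum.elim (w ∘ Sum.inl) (w ∘ Sum.inr) := by
      funext x; rcases x with x | x <;> rfl
    rw [hw, hψ₀]
    obtain ⟨r₀, c, B, hr, hB, h'⟩ := h (w ∘ Sum.inl) (w ∘ Sum.inr)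
    exact ⟨![r₀, B], c, ⟨hr, hB⟩, h'⟩

/-- **Taylor approximation in the models of `T_exp`** (den Besten 2016, (40), p. 88: "The
justification, of course, is that we can transfer Taylor's Theorem from `ℝ` to `K`"): for every
order `deg`, parameters `u` and centre `ω` in a model `K` there are a radius `r₀ > 0`, coefficients
`c` and a bound `B` with `|F(u, p) - Σ c_{k,j} Πₗ (p_{jₗ} - ω_{jₗ})| ≤ B t^{deg+1}` for
`0 < t < r₀`, `‖p - ω‖ < t` — by transfer of `exists_eSentence_taylor` from `ℝ` (`real_taylor`).
[cite: DenBesten2016, Theorem 7.1.22 (40)] -/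
theorem exists_taylor (P : MvPolynomial ((α ⊕ (β ⊕ κ)) ⊕ (α ⊕ (β ⊕ κ))) ℤ) (deg : ℕ)
    (K : Language.Theory.ModelType.{0, 0, 0} realExpTheory) (u : α → K) (ω : β ⊕ κ → K) :
    ∃ (r₀ : K) (c : (Σ k : Fin (deg + 1), (Fin k → β ⊕ κ)) → K) (B : K), 0 < r₀ ∧ 0 ≤ B ∧
      ∀ t : K, 0 < t → t < r₀ → ∀ p : β ⊕ κ → K, (∀ i, |p i - ω i| < t) →
        |MvPolynomial.aeval
            (Sum.elim (Sum.elim u p) (Sum.elim (fun i => EFun.e (u i))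
              (Sum.elim (fun i => EFun.e (p (Sum.inl i)))
                (fun j => if p (Sum.inr j) ^ 2 = 1 then 1
                  else EFun.e (p (Sum.inr j) / (1 - p (Sum.inr j) ^ 2)))))) P -
          ∑ ki, c ki * ∏ l, (p (ki.2 l) - ω (ki.2 l))| ≤ B * t ^ (deg + 1) := by
  obtain ⟨σ, hσ⟩ := exists_eSentence_taylor P deg
  have hR : ℝ ⊨ σ := (hσ ℝ).2 fun u ω => real_taylor P deg u ω
  have hK : (K : Type) ⊨ σ := (RealExpModel.realize_eSentence_iff_real K σ).2 hR
  exact (hσ K).1 hK u ω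

end Taylor

end SmoothFunctions

end Literature.ModelTheory.ExponentialFields
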